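import Summits.QuantumFields.BalabanUV.T4Continuum.Support.NE7ApeCurvedRepRoadBFinal
import Summits.QuantumFields.BalabanUV.T4Continuum.Support.NE7ApeCurvedRepPointedGaugeFourTerm
import Summits.QuantumFields.BalabanUV.T4Continuum.Support.NE7CovariantTentExtension
import HarnessLib

/-!
# NE7ApeCurvedRepRoadBSharpFourTerm — O2 RE-THREAD, FILE 9: the SHARP road (B) (`NE7ApeCurvedRepRoadBSharpH`: the covariant TENT extension `σ̃` of F114 with `‖gaugeDir_W σ̃‖ ≤ δ =
# corrC∕M·2θ_u` instead of the block-constant one, E′, F111, α₁ for E′'s `Z` alone) RE-CUT on F157 `NE7ApeCurvedRepPointedGaugeFourTerm`: `(S, hS, hG)` ↦ the FOUR-TERM letter `h4`;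
# the known gauge part `σ̃` feeds `K_Ξ·2θ_u`; the divergence datum is DISCHARGED as `d_C + (b₀ + 3c_RE b₀) + 2d·a_N` (pointing correction's letter `hDivCorr` displayed, E′'s
# clause, the crude kinematic bound on F111's lift); conclusion: the sharp road-(B) radius `+ K_D·(d_C + (b₀ + 3c_RE b₀) + 2d·a_N) + K_Ξ·2θ_u` (file 91 of the curved (APE), F161)

Cell `pub-balaban`, rung (B)+1 sub-cell t4, lineage `b2b-balaban-t4-ne7-p1` (CRUX PROVER NE7 #1 = OWNER of row NE7), generation 82; memo
`t4/b2b-balaban-t4-ne7-p1-g82/LOCALISATION-ROAD.md` §2 (O2).  Twin of `NE7ApeCurvedRepRoadBSharpH` (gen 80) over F157; E′, F114, F111, `norm_grad_structured_le` BY NAME as there.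
WHY.  The sharp chain (`…Sharp → …GradientSharp → …M → …Class` = the END of record's ancestry) on the four-term root; two files remain for the successor (`…GradientSharp` discharges
`hGradZ` by row NE3's gradient currency; `…M`∕`…Class` read the lines at `R = M` and from the class data), then the comb∕source ENDs if still wanted.
WHAT ([folklore]; 0 def, 0 sorry).  **`smallField_of_tanCritical_roadB_sharp_fourTerm`**.
HONEST FRAMING (page 1): composition over DISPLAYED letters (four-term letter, α₁^Z, `hDivCorr`) and PROVED suppliers (E′, F114, F111); the crude `2d·a_N` is kinematics, not a claim
that it closes; nothing of Bałaban's asserted; (APE) on curved data NOT proved; NOT ONE-STEP, NOT NE7; spine 0∕9; finite T⁴ rung (B)+1 — NOT infinite volume, NOT mass gap, NOT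
`BetaPertH`, NOT Clay.  Continuum YM on T⁴ ⇐ BetaPertH ∧ nine spine estimates (0/9 proved); BetaPertH ⇐ (D1) ∧ (D4) ∧ CAP+tail; G-an2-4 gates asym, D1 and NE2/3/4.
-/

set_option autoImplicit false

open scoped BigOperators Matrix Matrix.Norms.L2Operator
open NormedSpace Finset

namespace Summit.QuantumFields.BalabanUV.T4Continuum.NE7ApeCurvedRepRoadBSharpFourTerm

open Literature.MathematicalPhysics.QuantumFieldTheory.Balaban1983to89
open B7Prop1Explicit B7Prop2Explicit MatrixLog UnitaryModel
open T4AveragingDeficitWall (Ad IsUnitaryCfg IsSkewDir SmallField vary curlAt dirL1)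
open T4AveragingDeficitWallBoundary (IsPeriodicCfg periodBox)
open AveragingDeficitPeriodicCounting (IsPeriodicDir)
open AveragingDeficitTwoLevelPrep (twoLevelSmall)
open AveragingDeficitMultiLevelPrep (cavgIter LevelSmall)
open MinimalActionLevels (perWin)
open BlockAverageVaryHolo (nbRad)
open BlockAveragePushDirGauge (gaugeDir)
open NE3HessForm (hess dAction)
open NE3TangentCovariantTower (dirIter)
open NE3EnergyShapes (IsUnitarySite IsPeriodicSite)
open NE3CovariantWeitzenbock (covDiv)
open NE3RightInverseSupLetters (frameC)
open NE3QbarIterCovLiftPrep (cruxC)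
open NE3RightInverseSolveLetters (thetaLoc)
open NE3HatInvCurlLetters (curl1C)
open NE3.PairLandauB8 (IsLandauB8)
open BlockAverageVaryDisc (rho0)
open NE3LinearisedAverageSup (curvSum)
open NE3RightInverseSupLetters (supC)
open NE3RightInverseSolveLetters (cruxC_nonneg)
open NE3ResidualSliceRep (dirIter_sub)
open NE3.CurvedLandauRep (exists_landauRep_W)
open NE7ApeCurvedRepPointedGaugeFourTerm (smallField_of_tanCritical_pointedGauge_fourTerm)
open AveragingDeficitTransport (norm_Ad_of_unitary)
open NE7SameTopNormalLift (exists_normalLift_sameTop)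
open NE7ApeCurvedRepRoadBFinal (norm_grad_structured_le)
open NE7CovariantTentExtension (exists_tent_extension)
open NE3RightInverseSupLetters (corrC)

noncomputable section

variable {d : ℕ} {n : Type*} [Fintype n] [DecidableEq n]

/-- **ROAD (B), SHARP FORM, FOUR-TERM SLICE-SOLVER LETTER** — `NE7ApeCurvedRepRoadBSharpH.smallField_of_tanCritical_roadB_sharp` with `(S, hS, hG)` ↦ the four-term letter `h4`,
the pointing correction's divergence letter `hDivCorr` (tent-extension structure constants, `d_C`) displayed, E′'s divergence clause and F111's skewness + the crude `2d·a_N` divergence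
bound DISCHARGING the rest; conclusion = the original radius `+ K_D·(d_C + (b₀ + 3c_RE b₀) + 2d·a_N) + K_Ξ·2θ_u`. [folklore] -/
theorem smallField_of_tanCritical_roadB_sharp_fourTerm [Nonempty n] (hd : 2 ≤ d) {L N : ℕ} [NeZero N] (hL : 2 ≤ L) (j : ℕ)
    -- the background
    {W : Site d → Fin d → (Matrix n n ℂ)ˣ} {x : ℝ} (hWu : IsUnitaryCfg W) (hWP : IsPeriodicCfg W ((N * L ^ (j + 1) : ℕ) : ℤ))
    (hx : 0 ≤ x) (hs : LevelSmall d L j x) (hWx : SmallField W x)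
    -- the sup radius of the representative and the regime at `x′ = x + 4(e^{α₀} − 1)`
    {α₀ : ℝ} (hα0 : 0 ≤ α₀) (hs' : LevelSmall d L j (x + 4 * (Real.exp α₀ - 1)))
    (hθ : cruxC d L * (((L : ℝ) ^ (j + 1)) ^ 2 * (x + 4 * (Real.exp α₀ - 1))) < 1)
    (hθl : thetaLoc d L * (((L : ℝ) ^ (j + 1)) ^ 2 * (x + 4 * (Real.exp α₀ - 1))) < 1)
    (hε : ((L : ℝ) ^ (j + 1)) ^ 2 * (x + 4 * (Real.exp α₀ - 1)) ≤ 1)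
    -- the field: of the class, tangent-critical, over `W`'s datum
    {U : Site d → Fin d → (Matrix n n ℂ)ˣ} (hUu : IsUnitaryCfg U) (hUP : IsPeriodicCfg U ((N * L ^ (j + 1) : ℕ) : ℤ))
    {xU : ℝ} (hxU : 0 ≤ xU) (hsU : LevelSmall d L j xU) (hUxU : SmallField U xU)
    (hcritU : ∀ Y : Site d → Fin d → Matrix n n ℂ, IsSkewDir Y → IsPeriodicDir Y ((N * L ^ (j + 1) : ℕ) : ℤ) →
      dirIter L (j + 1) U Y = 0 → dAction U Y (perWin d (N * L ^ (j + 1))) = 0)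
    (hTopUW : cavgIter L (j + 1) U = cavgIter L (j + 1) W)
    -- row NE3's class data of `W` and E′'s initial gauge ∕ regime (as in `exists_landauRep_W`), the constant `c_RE` named; road (B)'s two extra regime lines
    {x₁ : ℝ} (hx10 : 0 ≤ x₁)
    (hgrad : ∀ (p : Site d) (μ κ : Fin d), κ ≠ μ →
      ‖Ad (W p μ) ((hol W (p + e μ) (plaqWord κ μ) : (Matrix n n ℂ)ˣ) : Matrix n n ℂ) - ((hol W p (plaqWord κ μ) : (Matrix n n ℂ)ˣ) : Matrix n n ℂ)‖ ≤ x₁)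
    (hbx : 23040 * (d : ℝ) ^ 4 * (frameC d L + d) ^ 2 * ((L : ℝ) ^ (j + 1)) ^ 2 * x ≤ 1)
    (hcx : 11520 * (d : ℝ) ^ 4 * (frameC d L + d) ^ 3 * ((L : ℝ) ^ (j + 1)) ^ 3 * x₁ ≤ 1)
    (hbx' : 256 * (d : ℝ) ^ 2 * ((L : ℝ) ^ (j + 1)) ^ 2 * x ≤ 1) (hcx' : 16 * (d : ℝ) * ((L : ℝ) ^ (j + 1)) ^ 3 * x₁ ≤ 1)
    {r₀ b₀ : ℝ} (hr₀ : ∀ (y : Site d) (μ : Fin d), ‖(((W y μ)⁻¹ * U y μ : (Matrix n n ℂ)ˣ) : (Matrix n n ℂ)) - 1‖ ≤ r₀)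
    (hb₀ : ∀ x : Site d, ‖covDiv W (fun y μ => mlog (((W y μ)⁻¹ * U y μ : (Matrix n n ℂ)ˣ) : (Matrix n n ℂ))) x‖ ≤ b₀)
    {cRE : ℝ} (hcRE : cRE = 1 + 2 * (Fintype.card n : ℝ) * (64 * (d : ℝ) ^ 2 * N) ^ d + 27 * (Fintype.card n : ℝ) ^ 3 * (512 : ℝ) ^ d * (N : ℝ) ^ d)
    (hreg₁ : (36 * (d : ℝ) * (frameC d L + d) ^ 2) * ((L : ℝ) ^ (j + 1)) ^ 2 * (cRE * b₀) ≤ 1 / 10)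
    (hreg₂ : (36 * (d : ℝ) * (frameC d L + d)) * (L : ℝ) ^ (j + 1) * (cRE * b₀) ≤ 1 / 25)
    (hreg₃ : r₀ + 5 / 2 * ((36 * (d : ℝ) * (frameC d L + d)) * (L : ℝ) ^ (j + 1) * (cRE * b₀)) ≤ 1 / 20)
    (hline : cRE * (4 * ((36 * (d : ℝ) * (frameC d L + d) ^ 2) * ((L : ℝ) ^ (j + 1)) ^ 2) * (b₀ + 4 * (cRE * b₀))
        + 25 * d * (r₀ + 5 / 2 * ((36 * (d : ℝ) * (frameC d L + d)) * (L : ℝ) ^ (j + 1) * (cRE * b₀))) * ((36 * (d : ℝ) * (frameC d L + d)) * (L : ℝ) ^ (j + 1))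
        + 14 * d * ((36 * (d : ℝ) * (frameC d L + d)) * (L : ℝ) ^ (j + 1)) ^ 2 * (cRE * b₀)) ≤ 1 / 2)
    -- E′'s radii named: `α_E`, `θ_u`; the tent extension's `δ = corrC∕M·2θ_u`; road (B)'s regime `α_E ≤ 1∕40`, `θ_u ≤ 1∕160`, `δ ≤ 1∕40`, `α₀ ≥ α_E + δ + 4(2θ_u+δ)(α_E+δ)`
    {αE θu : ℝ} (hαE : αE = 2 * (r₀ + 5 / 2 * ((36 * (d : ℝ) * (frameC d L + d)) * (L : ℝ) ^ (j + 1) * (cRE * b₀))))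
    (hθu : θu = 4 * ((36 * (d : ℝ) * (frameC d L + d) ^ 2) * ((L : ℝ) ^ (j + 1)) ^ 2 * (cRE * b₀)))
    (hαE40 : αE ≤ 1 / 40) (hθu160 : θu ≤ 1 / 160)
    {δ : ℝ} (hδ : δ = corrC d / (L : ℝ) ^ (j + 1) * (2 * θu)) (hδ40 : δ ≤ 1 / 40) (hα₀ : αE + δ + 4 * (2 * θu + δ) * (αE + δ) ≤ α₀)
    -- the remaining analytic letters at `W`: (L1)′ and α₁ for the SAME-TOP structured fields of radius `α₀`, (L2), (L3) discharged
    -- (L1)′ DISCHARGED (F111): the quadratic-remainder regime, the slice `S` containing the `W`-tangent skew periodic fields, and the names `c_N = 4m`, `ν = 24·#Plane·m`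
    (hs1 : LevelSmall d L (j + 1) x) (hA : curvSum d L (j + 1) x ≤ 2 / 3 * L) (hσ0 : 4 * (3 + 12 * (d : ℝ)) ^ 2 * (L : ℝ) ^ (j + 1) * α₀ ≤ rho0 d L ^ 2)
    {cN aN dC KG KX KD KΞ ν : ℝ}
    -- the pointing correction's divergence letter (memo O2: face-supported; displayed until priced), for the TENT extension's structure constants
    (hDivCorr : ∀ (Z : Site d → Fin d → Matrix n n ℂ) (σ : Site d → Matrix n n ℂ) (Z' : Site d → Fin d → Matrix n n ℂ),
      IsSkewDir Z → IsPeriodicDir Z ((N * L ^ (j + 1) : ℕ) : ℤ) → IsLandauB8 (d := d) L N (j + 1) W Z → (∀ y μ, ‖Z y μ‖ ≤ αE) →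
      (∀ y, σ y ∈ skewAdjoint (Matrix n n ℂ)) → (∀ (y : Site d) (i : Fin d), σ (y + ((N * L ^ (j + 1) : ℕ) : ℤ) • e i) = σ y) →
      (∀ y, ‖σ y‖ ≤ 2 * θu) → (∀ (y : Site d) (κ : Fin d), ‖gaugeDir W σ y κ‖ ≤ δ) →
      IsSkewDir Z' → IsPeriodicDir Z' ((N * L ^ (j + 1) : ℕ) : ℤ) →
      (∀ y μ, ‖Z' y μ‖ ≤ α₀) → cavgIter L (j + 1) (vary W Z' 1) = cavgIter L (j + 1) W →
      (∀ (y : Site d) (μ : Fin d), ‖Z' y μ - (Z y μ - gaugeDir W σ y μ)‖ ≤ 4 * (2 * θu + δ) * (αE + δ)) →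
      ∀ y : Site d, ‖covDiv W (fun z κ => Z' z κ - (Z z κ - gaugeDir W σ z κ)) y‖ ≤ dC)
    (haN : aN = (supC d L / ((L : ℝ) ^ (j + 1) * (1 - cruxC d L * (((L : ℝ) ^ (j + 1)) ^ 2 * x)))
        * (4 * (3 + 12 * (d : ℝ)) ^ 3 / rho0 d L ^ 2 * ((L : ℝ) ^ (j + 1) * α₀) ^ 2)))
    (hcN : cN = 4 * (supC d L / ((L : ℝ) ^ (j + 1) * (1 - cruxC d L * (((L : ℝ) ^ (j + 1)) ^ 2 * x)))
        * (4 * (3 + 12 * (d : ℝ)) ^ 3 / rho0 d L ^ 2 * ((L : ℝ) ^ (j + 1) * α₀) ^ 2)))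
    (hνm : ν = 24 * (Fintype.card (T4AveragingDeficitWall.Plane d) : ℝ) * (supC d L / ((L : ℝ) ^ (j + 1) * (1 - cruxC d L * (((L : ℝ) ^ (j + 1)) ^ 2 * x)))
        * (4 * (3 + 12 * (d : ℝ)) ^ 3 / rho0 d L ^ 2 * ((L : ℝ) ^ (j + 1) * α₀) ^ 2)))
    -- α₁ FOR E′'s LANDAU REPRESENTATIVE ALONE
    {α₁Z : ℝ} (hα1Z : 0 ≤ α₁Z)
    (hGradZ : ∀ Z : Site d → Fin d → Matrix n n ℂ, IsSkewDir Z → IsPeriodicDir Z ((N * L ^ (j + 1) : ℕ) : ℤ) → IsLandauB8 (d := d) L N (j + 1) W Z →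
      (∀ y μ, ‖Z y μ‖ ≤ αE) → ∀ (y : Site d) (κ τ : Fin d), ‖Ad (W (y + e κ) τ) (Z (y + e τ) κ) - Z y κ‖ ≤ α₁Z)
    -- THE FOUR-TERM SLICE-SOLVER LETTER (F152's shape) on all skew periodic `W`-tangent fields
    (h4 : ∀ X : Site d → Fin d → Matrix n n ℂ, IsSkewDir X →
      IsPeriodicDir X ((N * L ^ (j + 1) : ℕ) : ℤ) → dirIter L (j + 1) W X = 0 → ∀ R : ℝ, (∀ y κ', ‖X y κ'‖ ≤ R) → ∀ g : ℝ, 0 ≤ g →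
      (∀ Y : Site d → Fin d → Matrix n n ℂ, IsSkewDir Y → IsPeriodicDir Y ((N * L ^ (j + 1) : ℕ) : ℤ) → dirIter L (j + 1) W Y = 0 →
        |hess W X Y (perWin d (N * L ^ (j + 1)))| ≤ g * dirL1 Y (periodBox (d := d) (N * L ^ (j + 1)))) →
      ∀ σ' : Site d → Matrix n n ℂ, (∀ y, σ' y ∈ skewAdjoint (Matrix n n ℂ)) →
      (∀ (y : Site d) (i : Fin d), σ' (y + ((N * L ^ (j + 1) : ℕ) : ℤ) • e i) = σ' y) → ∀ Ξ' : ℝ, (∀ y, ‖σ' y‖ ≤ Ξ') →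
      ∀ D : ℝ, (∀ y, ‖covDiv W (fun z κ => X z κ + gaugeDir W σ' z κ) y‖ ≤ D) →
      ∀ z μ' ν', μ' ≠ ν' → ‖curlAt W X z μ' ν'‖ ≤ KG * g + KX * R + KD * D + KΞ * Ξ')
    (hcritW : ∀ Y : Site d → Fin d → Matrix n n ℂ, IsSkewDir Y → IsPeriodicDir Y ((N * L ^ (j + 1) : ℕ) : ℤ) → dirIter L (j + 1) W Y = 0 →
      dAction W Y (perWin d (N * L ^ (j + 1))) = 0) :
    SmallField U (x + (KG * (
        ((x + 4 * (Real.exp α₀ - 1))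
            * ((curl1C d L / (1 - thetaLoc d L * (((L : ℝ) ^ (j + 1)) ^ 2 * (x + 4 * (Real.exp α₀ - 1)))))
                * (((L : ℝ) ^ (j + 1)) ^ d / ((L : ℝ) ^ (j + 1)) ^ 2))
            * (Real.exp (((L : ℝ) ^ d / L) * ((d : ℝ) * (16 * ((d : ℝ) + 1) * ((d : ℝ) + 4) * (L : ℝ) ^ 2)
                  * (1250 * ((nbRad d L : ℝ) + L) + 8 * ((d : ℝ) * L) + 2 * L)) * (2 / twoLevelSmall d L))
                * ((L : ℝ) / (L : ℝ) ^ d) ^ j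
                * (((d : ℝ) * (2 * nbRad d L + 1) ^ d) * ((2 * (d : ℝ) + 4) * (L : ℝ) ^ 2) * (2 * (L : ℝ) ^ j) * (Real.exp α₀ - 1)
                  + (17 / 8 * ((L : ℝ) ^ 2) ^ j * (x + 4 * (Real.exp α₀ - 1)))
                    * (((d : ℝ) * (2 * nbRad d L + 1) ^ d) * ((2 * (d : ℝ) + 4)
                          * (2 * (2 * L * (nbRad d L : ℝ) + 128 * ((d : ℝ) + 1) * ((d : ℝ) + 4) * (L : ℝ) ^ 2)))
                      + ((d : ℝ) * (2 * nbRad d L + 1) ^ d) * ((2 * (d : ℝ) + 4) * (L : ℝ) ^ 2 * (2 * (nbRad d L : ℝ))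
                          + 2 * (8 * (L : ℝ) + (1250 * ((nbRad d L : ℝ) + L) + 8 * (d * L) + 2 * L))
                              * (16 * ((d : ℝ) + 1) * ((d : ℝ) + 4) * (L : ℝ) ^ 2))))))
        + (Fintype.card (T4AveragingDeficitWall.Plane d) : ℝ)
          * (2 * (240 * (Real.exp α₀ - 1) * α₀ * (2 * (α₁Z + 2 * δ + 2 * (4 * (2 * θu + δ) * (αE + δ))) + 24 * α₀ * (Real.exp α₀ - 1) + x) + 8 * α₀ * (2 * (α₁Z + 2 * δ + 2 * (4 * (2 * θu + δ) * (αE + δ))) + 24 * α₀ * (Real.exp α₀ - 1))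
              + 6 * (Real.exp α₀ - 1) * (2 * (α₁Z + 2 * δ + 2 * (4 * (2 * θu + δ) * (αE + δ))) + 24 * (Real.exp α₀ - 1) * α₀)
              + (2 * (α₁Z + 2 * δ + 2 * (4 * (2 * θu + δ) * (αE + δ))) + 24 * (Real.exp α₀ - 1) * α₀) * (2 * (α₁Z + 2 * δ + 2 * (4 * (2 * θu + δ) * (αE + δ))) + 24 * α₀ * (Real.exp α₀ - 1))
              + 960 * (Real.exp α₀ - 1) * α₀ ^ 2 + 32 * x * α₀ ^ 2)
            + (64 * α₀ * (α₁Z + 2 * δ + 2 * (4 * (2 * θu + δ) * (αE + δ))) + 1024 * x * α₀ ^ 2))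
        + ν) + KX * (α₀ + aN) + KD * (dC + (b₀ + 3 * (cRE * b₀)) + 2 * (d : ℝ) * aN) + KΞ * (2 * θu) + cN + 28 * α₀ ^ 2)) := by
  have hd1 : 1 ≤ d := by omega
  have hL1 : 1 ≤ L := by omega
  -- the right-inverse regime at `x` from the one at `x′ ≥ x`
  have hexp : 0 ≤ 4 * (Real.exp α₀ - 1) := by have := Real.add_one_le_exp α₀; linarith
  have hM2 : 0 ≤ ((L : ℝ) ^ (j + 1)) ^ 2 := by positivity
  have hxx' : ((L : ℝ) ^ (j + 1)) ^ 2 * x ≤ ((L : ℝ) ^ (j + 1)) ^ 2 * (x + 4 * (Real.exp α₀ - 1)) :=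
    mul_le_mul_of_nonneg_left (by linarith) hM2
  have hθx : cruxC d L * (((L : ℝ) ^ (j + 1)) ^ 2 * x) < 1 :=
    (mul_le_mul_of_nonneg_left hxx' (cruxC_nonneg d L)).trans_lt hθ
  have hεx : ((L : ℝ) ^ (j + 1)) ^ 2 * x ≤ 1 := hxx'.trans hε
  have h1θ : 0 < 1 - cruxC d L * (((L : ℝ) ^ (j + 1)) ^ 2 * x) := by linarith
  have hsupC0 : 0 ≤ supC d L := by
    unfold supC NE3RightInverseSupLetters.corrC NE3RightInverseSupLetters.frameC; have := NE3QbarIterCovLiftPrep.liftC_nonneg d; positivity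
  have hν : 0 ≤ ν := by rw [hνm]; positivity
  -- signs of the named radii, then unfold the names
  have hb0 : 0 ≤ b₀ := (norm_nonneg _).trans (hb₀ 0)
  have hr0 : 0 ≤ r₀ := (norm_nonneg _).trans (hr₀ 0 ⟨0, by omega⟩)
  have hfr : 0 ≤ frameC d L := by unfold frameC; positivity
  have hc0 : 0 ≤ corrC d := zero_le_one.trans (NE3RightInverseSupLetters.one_le_corrC d)
  have hθu0 : 0 ≤ θu := by rw [hθu, hcRE]; positivity
  have hαE0 : 0 ≤ αE := by rw [hαE, hcRE]; positivity
  have hδ0 : 0 ≤ δ := by rw [hδ]; positivity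
  have hα1 : 0 ≤ α₁Z + 2 * δ + 2 * (4 * (2 * θu + δ) * (αE + δ)) := by positivity
  have ht40 : 2 * θu ≤ 1 / 40 := by linarith
  have hθu4 : θu ≤ 1 / 4 := by linarith
  subst hcRE hαE hθu hδ
  -- E′
  obtain ⟨u, Z, huU, huP, hZs, hZP, hrep, hLan, -, hZsup, hu1, hZdiv⟩ :=
    exists_landauRep_W hd1 hL j hWu hWP hx hs hWx hx10 hgrad hbx hcx hbx' hcx' hUu hUP hr₀ hb₀ hreg₁ hreg₂ hreg₃ hline
  -- F114: the covariant tent extension of `u`'s corner values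
  obtain ⟨σ, hσs, hσP, hext, hσt, hσδ⟩ :=
    exists_tent_extension hL N j hWu hWP hx hs hWx hεx huU huP hu1 hθu4
  -- F108 with (L1)′ by F111 and α₁ by the three-term split
  refine smallField_of_tanCritical_pointedGauge_fourTerm hd hL j hWu hWP hx hs hWx hα0 hs' hθ hθl hε hUu hUP hxU hsU hUxU hcritU hTopUW huU huP hrep hZsup hαE40
    hσs hσP hext hσt hσδ ht40 hδ40 hα₀ hν hZdiv
    (fun Z' hZ's hZ'P hZ'α hTop hstr => hDivCorr Z σ Z' hZs hZP hLan hZsup hσs hσP hσt hσδ hZ's hZ'P hZ'α hTop hstr) ?_ hα1 ?_ h4 hcritW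
  · -- (L1)′ by F111, with the normal lift's skewness and the CRUDE divergence bound `‖covDiv W A_N‖ ≤ 2d·a_N` (memo O2(ii))
    intro Z' hZ's hZ'P hZ'α hTop _
    obtain ⟨AN, hANs, hANP, hANex, hANsup, hANcurl, hANhess⟩ :=
      exists_normalLift_sameTop hL j hWu hWP hx hs hs1 hWx hθx hεx hA hZ's hZ'P hα0 hZ'α hσ0 hTop
    have hANsup' : ∀ (y : Site d) (μ : Fin d), ‖AN y μ‖ ≤ aN := fun y μ => by rw [haN]; exact hANsup y μ
    refine ⟨AN, hANP, hANsup', hANex, fun z μ' ν' hne => ?_, fun Y _ hYP _ => ?_, hANs, fun y => ?_⟩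
    · rw [hcN]; exact hANcurl z μ' ν' hne
    · rw [hνm]; exact hANhess Y hYP
    · unfold NE3CovariantWeitzenbock.covDiv
      calc ‖∑ μ : Fin d, (Ad (W y μ) (AN y μ) - AN (y - e μ) μ)‖
          ≤ ∑ μ : Fin d, ‖Ad (W y μ) (AN y μ) - AN (y - e μ) μ‖ := norm_sum_le _ _
        _ ≤ ∑ _μ : Fin d, (aN + aN) := Finset.sum_le_sum fun μ _ =>
            (norm_sub_le _ _).trans (add_le_add (by rw [norm_Ad_of_unitary (hWu y μ)]; exact hANsup' y μ) (hANsup' _ μ))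
        _ = 2 * (d : ℝ) * aN := by rw [Finset.sum_const, Finset.card_univ, Fintype.card_fin, nsmul_eq_mul]; ring
  · intro Z' _ _ _ _ hstr y κ τ
    have h := norm_grad_structured_le (hWu (y + e κ) τ) (Z (y + e τ) κ) (Z y κ) (gaugeDir W σ (y + e τ) κ) (gaugeDir W σ y κ) (Z' (y + e τ) κ) (Z' y κ)
    linarith [hGradZ Z hZs hZP hLan hZsup y κ τ, hσδ (y + e τ) κ, hσδ y κ, hstr (y + e τ) κ, hstr y κ]

end

end Summit.QuantumFields.BalabanUV.T4Continuum.NE7ApeCurvedRepRoadBSharpFourTerm
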